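import Literature.Barriers.Parity.SmallScalePatternsAP
import Literature.NumberTheory.Sieve.LinearEquationsInPrimesLevelTwoAllSystems
import Literature.NumberTheory.Sieve.PrimeThreeTermProgressions
import Mathlib.Analysis.SpecialFunctions.Integrals.Basic
import HarnessLib

/-!
# Green–Tao 2010, Example 8: `k`-term arithmetic progressions of primes up to `N` (and Example 5, `k = 4`)

Topic `Literature/NumberTheory/Sieve`. Source: B. Green, T. Tao, *Linear equations in primes*,
Ann. of Math. 171 (2010), §1 (arXiv:math/0606088 p. 7):

> **Example 8 (APs of length `k`).** Let `k ≥ 2` be a fixed integer. Assume the `GI(k−2)`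
> conjecture and the `MN(k−2)` conjecture. Then the number of `k`-tuples of primes
> `p₁ < p₂ < ⋯ < p_k ≤ N` which lie in arithmetic progression is
> `(1/(2(k−1)) ∏_p β_p + o_k(1)) N²/log^k N`, where `β_p = (1/p)(p/(p−1))^{k−1}` if `p ≤ k` and
> `β_p = (1 − (k−1)/p)(p/(p−1))^{k−1}` if `p ≥ k`. The `k = 4` case of this is Example 5; the
> `k = 3` case is due to van der Corput; and the `k = 1, 2` cases are equivalent to the prime
> number theorem.

> **Example 5 (APs of length 4).** The number of `4`-tuples of primes `p₁ < p₂ < p₃ < p₄ ≤ N`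
> which lie in arithmetic progression is `(1 + o(1)) 𝔖₁ N²/log⁴ N`, where
> `𝔖₁ = ¾ ∏_{p ≥ 5} (1 − (3p−1)/(p−1)³) ≈ 0.4764` … `β_∞ = N²/6`, `β₂ = 4`, `β₃ = 9/8`, and
> `β_p = 1 − (3p−1)/(p−1)³` for `p ≥ 5`.

Kernel form. `GI(k−2) ∧ MN(k−2)` enter Green–Tao's argument only through the Main Theorem at
complexity `k − 2` (`GreenTao2010_mainTheoremAtComplexity (k-2)`, whose counting form (1.8) is
`GreenTao2010_primePointCount_of_mainTheoremAtComplexity`); we prove Example 8 from that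
hypothesis (`GreenTao2010_example8`), for the system `apSystem k = (n₁, n₁ + n₂, …, n₁ + (k−1)n₂)`
(complexity `k − 2`, `complexity_arithProg`) on the triangle
`apRegion k N = {1 ≤ x, 1 ≤ y, x + (k−1)y ≤ N}` (`β_∞ = (N−k)²/(2(k−1))`, `archFactor_apSystem`),
with the local factors `β_p` COMPUTED (`localFactor_apSystem`; the case `p ≥ k` is the tree's
`Literature.Barriers.Parity.APSystem.localFactor_eq`, the case `p ≤ k` is new here). Hence:

* `k = 2` and `k = 3` UNCONDITIONALLY (`GreenTao2010_example8_two`: `#{p₁ < p₂ ≤ N} ∼ N²/(2log²N)`;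
  `GreenTao2010_example8_three_ap`, the same statement as van der Corput's theorem
  `GreenTao2010_example8_three` of `PrimeThreeTermProgressionsAsymptotic` since
  `primeAPCount 3 = primeThreeAPCount` (`primeAPCount_three`) and `apSystem 3 = threeAPSystem`);
* `k = 4` = **Example 5** from the named facts `GITwo`, `MNTwo` (Green–Tao's inverse `U³` theorem
  and cubic Möbius–nilsequences estimate, the tree's hypotheses of
  `GreenTao2010_mainTheoremAtComplexity_two_of_GI_of_MN`): `GreenTao2010_example5_of_GI_of_MN`,
  with `β₂ = 4`, `β₃ = 9/8`, `β_p = 1 − (3p−1)/(p−1)³` (`localFactor_apSystem_four`).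

## References

* [GreenTao2010] B. Green, T. Tao, *Linear equations in primes*, Ann. of Math. (2) 171 (2010),
  §1 Examples 5 and 8, Examples 1, (1.4), (1.6), (1.8).
-/

noncomputable section

open MeasureTheory Set Finset
open Literature.Barriers.Parity

namespace Literature.NumberTheory.Sieve

variable {k : ℕ}

/-! ### The progression system: complexity and size -/

/-- `(n₁, n₁ + n₂, …, n₁ + (m+1) n₂)` has complexity `m` (= `k − 2` for `k = m + 2` terms).
[cite: GreenTao2010, Examples 1] -/
theorem complexity_apSystem (m : ℕ) : complexity (apSystem (m + 2)) = (m : ℕ) :=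
  complexity_arithProg m

/-- `‖Ψ‖_N = ∑_{i<k} (1 + i) ≤ k²` at every scale. [cite: GreenTao2010, (1.1)] -/
theorem affLinSize_apSystem_le (k : ℕ) (N : ℝ) :
    affLinSize (apSystem k) N ≤ ((k * k : ℕ) : ℝ) := by
  unfold affLinSize
  have h1 : ∀ i : Fin k, ∑ j : Fin 2, |(((apSystem k i).coeff j : ℤ) : ℝ)| = 1 + (i : ℕ) := by
    intro i
    simp [apSystem, Fin.sum_univ_two]
  have h2 : ∀ i : Fin k, |(((apSystem k i).const : ℤ) : ℝ) / N| = 0 := by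
    intro i
    simp [apSystem]
  simp only [h1, h2, Finset.sum_const_zero, add_zero]
  calc ∑ i : Fin k, (1 + ((i : ℕ) : ℝ)) ≤ ∑ _i : Fin k, (k : ℝ) :=
        Finset.sum_le_sum fun i _ => by
          have := i.isLt
          have : (1 : ℝ) + (i : ℕ) ≤ k := by exact_mod_cast (by omega : 1 + (i : ℕ) ≤ k)
          exact this
    _ = ((k * k : ℕ) : ℝ) := by simp

/-- `ψᵢ(x) = x₁ + i x₂` over `ℝ`. [cite: GreenTao2010, Examples 1] -/
@[simp] theorem realEval_apSystem (i : Fin k) (x : Fin 2 → ℝ) :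
    (apSystem k i).realEval x = x 0 + (i : ℝ) * x 1 := by
  simp [apSystem, AffLinForm.realEval, Fin.sum_univ_two]

/-! ### The region and the count -/

/-- The triangle `{(x, y) : 1 ≤ x, 1 ≤ y, x + (k−1)y ≤ N}`: first term `x ≥ 1`, common difference
`y ≥ 1`, last term `x + (k−1)y ≤ N`. [cite: GreenTao2010, §1 Examples 5 and 8] -/
def apRegion (k N : ℕ) : Set (Fin 2 → ℝ) :=
  {v | 1 ≤ v 0 ∧ 1 ≤ v 1 ∧ v 0 + ((k : ℝ) - 1) * v 1 ≤ N}

/-- The triangle is convex. [cite: GreenTao2010, §1 Example 8] -/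
theorem convex_apRegion (k N : ℕ) : Convex ℝ (apRegion k N) := by
  intro x hx y hy a b ha hb hab
  obtain ⟨hx0, hx1, hx2⟩ := hx
  obtain ⟨hy0, hy1, hy2⟩ := hy
  simp only [apRegion, Set.mem_setOf_eq, Pi.add_apply, Pi.smul_apply, smul_eq_mul]
  refine ⟨?_, ?_, ?_⟩
  · calc (1 : ℝ) = a * 1 + b * 1 := by rw [mul_one, mul_one, hab]
      _ ≤ a * x 0 + b * y 0 := add_le_add (mul_le_mul_of_nonneg_left hx0 ha)
          (mul_le_mul_of_nonneg_left hy0 hb)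
  · calc (1 : ℝ) = a * 1 + b * 1 := by rw [mul_one, mul_one, hab]
      _ ≤ a * x 1 + b * y 1 := add_le_add (mul_le_mul_of_nonneg_left hx1 ha)
          (mul_le_mul_of_nonneg_left hy1 hb)
  · calc a * x 0 + b * y 0 + ((k : ℝ) - 1) * (a * x 1 + b * y 1)
        = a * (x 0 + ((k : ℝ) - 1) * x 1) + b * (y 0 + ((k : ℝ) - 1) * y 1) := by ring
      _ ≤ a * N + b * N := add_le_add (mul_le_mul_of_nonneg_left hx2 ha)
          (mul_le_mul_of_nonneg_left hy2 hb)
      _ = N := by rw [← add_mul, hab, one_mul]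

/-- For `k ≥ 2` the triangle lies in `[−N, N]²`. [cite: GreenTao2010, §1 Example 8] -/
theorem apRegion_subset_realBox (hk : 2 ≤ k) (N : ℕ) : apRegion k N ⊆ realBox 2 (N : ℝ) := by
  intro v hv
  obtain ⟨h0, h1, h2⟩ := hv
  have hN : (0 : ℝ) ≤ N := Nat.cast_nonneg N
  have hk' : (2 : ℝ) ≤ k := by exact_mod_cast hk
  have h3 : v 1 ≤ ((k : ℝ) - 1) * v 1 := by nlinarith
  have h4 : 0 ≤ ((k : ℝ) - 1) * v 1 := by nlinarith
  refine ⟨fun j => ?_, fun j => ?_⟩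
  · fin_cases j <;> simp <;> linarith
  · fin_cases j <;> simp <;> linarith

/-- On the triangle every form is positive. [cite: GreenTao2010, §1 Example 8] -/
theorem realEval_apSystem_pos {N : ℕ} {v : Fin 2 → ℝ} (hv : v ∈ apRegion k N) (i : Fin k) :
    0 < (apSystem k i).realEval v := by
  obtain ⟨h0, h1, -⟩ := hv
  rw [realEval_apSystem]
  have : (0 : ℝ) ≤ (i : ℝ) * v 1 := mul_nonneg (Nat.cast_nonneg _) (by linarith)
  linarith

/-- **The number of `k`-term arithmetic progressions of primes `p₁ < p₂ < ⋯ < p_k ≤ N`**,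
parametrised by first term `a = p₁` and common difference `b ≥ 1`:
`#{(a, b) : a, b ≥ 1, a + (k−1)b ≤ N, a + ib prime (i < k)}`. [cite: GreenTao2010, §1 Example 8] -/
def primeAPCount (k N : ℕ) : ℕ :=
  #((range (N + 1) ×ˢ range (N + 1)).filter fun q =>
      1 ≤ q.1 ∧ 1 ≤ q.2 ∧ q.1 + (k - 1) * q.2 ≤ N ∧ ∀ i : Fin k, (q.1 + (i : ℕ) * q.2).Prime)

/-- [folklore] -/
private theorem mem_latticeBox_two {N : ℕ} {n : Fin 2 → ℤ} :
    n ∈ latticeBox 2 N ↔ (-(N : ℤ) ≤ n 0 ∧ n 0 ≤ N) ∧ (-(N : ℤ) ≤ n 1 ∧ n 1 ≤ N) := by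
  unfold latticeBox
  rw [Fintype.mem_piFinset, Fin.forall_fin_two, Finset.mem_Icc, Finset.mem_Icc]

/-- [folklore] -/
private theorem realPoint_mem_apRegion {N : ℕ} {n : Fin 2 → ℤ} :
    realPoint n ∈ apRegion k N ↔ 1 ≤ n 0 ∧ 1 ≤ n 1 ∧ n 0 + ((k : ℤ) - 1) * n 1 ≤ N := by
  simp only [apRegion, realPoint, Set.mem_setOf_eq]
  refine ⟨fun ⟨h0, h1, h2⟩ => ⟨by exact_mod_cast h0, by exact_mod_cast h1, by exact_mod_cast h2⟩,
    fun ⟨h0, h1, h2⟩ => ⟨by exact_mod_cast h0, by exact_mod_cast h1, by exact_mod_cast h2⟩⟩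

/-- [folklore] -/
private theorem natPair_cond_iff (hk : 1 ≤ k) (a b N : ℕ) :
    a + (k - 1) * b ≤ N ↔ (a : ℤ) + ((k : ℤ) - 1) * b ≤ N := by
  have e : (((a + (k - 1) * b : ℕ) : ℤ)) = (a : ℤ) + ((k : ℤ) - 1) * b := by
    push_cast [Nat.cast_sub hk]
    ring
  rw [← e, Nat.cast_le]

/-- **The progression count is the prime-point count of `apSystem k` on the triangle**
(`(a, b) ↦ (a, b) ∈ ℤ²`). [cite: GreenTao2010, §1 Example 8] -/
theorem primeAPCount_eq (hk : 1 ≤ k) (N : ℕ) :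
    primeAPCount k N = primePointCount (apSystem k) (apRegion k N) N := by
  classical
  unfold primeAPCount primePointCount
  refine Finset.card_nbij' (fun q => ![(q.1 : ℤ), (q.2 : ℤ)])
    (fun n => ((n 0).toNat, (n 1).toNat)) ?_ ?_ ?_ ?_
  · intro q hq
    rw [Finset.mem_coe, Finset.mem_filter, Finset.mem_product, Finset.mem_range,
      Finset.mem_range] at hq
    obtain ⟨⟨ha, hb⟩, ha1, hb1, hc, hp⟩ := hq
    rw [Finset.mem_coe, Finset.mem_filter, mem_latticeBox_two, realPoint_mem_apRegion]
    simp only [Matrix.cons_val_zero, Matrix.cons_val_one, APSystem.eval_eq]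
    refine ⟨⟨⟨by omega, by omega⟩, by omega, by omega⟩,
      ⟨by exact_mod_cast ha1, by exact_mod_cast hb1, (natPair_cond_iff hk _ _ _).mp hc⟩, fun i => ?_⟩
    rw [show (q.1 : ℤ) + (i : ℤ) * (q.2 : ℤ) = ((q.1 + i * q.2 : ℕ) : ℤ) by push_cast; ring,
      Int.toNat_natCast]
    exact hp i
  · intro n hn
    rw [Finset.mem_coe, Finset.mem_filter, mem_latticeBox_two, realPoint_mem_apRegion] at hn
    obtain ⟨⟨⟨-, hA⟩, -, hB⟩, ⟨h0, h1, h2⟩, hp⟩ := hn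
    obtain ⟨A, hA'⟩ := Int.eq_ofNat_of_zero_le (by omega : (0 : ℤ) ≤ n 0)
    obtain ⟨B, hB'⟩ := Int.eq_ofNat_of_zero_le (by omega : (0 : ℤ) ≤ n 1)
    simp only [APSystem.eval_eq, hA', hB', Int.toNat_natCast] at hp ⊢
    rw [hA'] at hA h0 h2
    rw [hB'] at hB h1 h2
    rw [Finset.mem_coe, Finset.mem_filter, Finset.mem_product, Finset.mem_range, Finset.mem_range]
    refine ⟨⟨by omega, by omega⟩, by exact_mod_cast h0, by exact_mod_cast h1,
      (natPair_cond_iff hk _ _ _).mpr h2, fun i => ?_⟩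
    have := hp i
    rwa [show (A : ℤ) + (i : ℤ) * (B : ℤ) = ((A + i * B : ℕ) : ℤ) by push_cast; ring,
      Int.toNat_natCast] at this
  · intro q hq
    simp
  · intro n hn
    rw [Finset.mem_coe, Finset.mem_filter, realPoint_mem_apRegion] at hn
    obtain ⟨-, ⟨h0, h1, -⟩, -⟩ := hn
    funext j
    fin_cases j
    · simp; omega
    · simp; omega

/-- For `k = 3` this is the count of `PrimeThreeTermProgressions`
(`(a, b) ↦ (a, a + b, a + 2b)`). [cite: GreenTao2010, §1 Example 8] -/
theorem primeAPCount_three (N : ℕ) : primeAPCount 3 N = primeThreeAPCount N := by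
  rw [primeAPCount_eq (by norm_num), primeThreeAPCount_eq]
  have h1 : apSystem 3 = threeAPSystem := rfl
  have h2 : apRegion 3 N = threeAPRegion N := by
    ext v
    simp only [apRegion, threeAPRegion, Set.mem_setOf_eq]
    norm_num
  rw [h1, h2]

/-! ### The local factors `β_p` -/

/-- For a prime `p ≤ k`: the residues `(x, y) ∈ (ℤ/p)²` with `x + iy ≠ 0` for all `i < k` are
exactly those with `y = 0`, `x ≠ 0` (for `y ≠ 0` the `k ≥ p` values `−iy` cover `ℤ/p`), so
there are `p − 1` of them. [cite: GreenTao2010, §1 Example 8] -/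
theorem APSystem_card_good_of_le {p : ℕ} [hp : Fact p.Prime] (hk : p ≤ k) :
    #{v : ZMod p × ZMod p | ∀ i : Fin k, v.1 + ((i : ℕ) : ZMod p) * v.2 ≠ 0} = p - 1 := by
  classical
  have hset : ({v : ZMod p × ZMod p | ∀ i : Fin k, v.1 + ((i : ℕ) : ZMod p) * v.2 ≠ 0} :
      Finset (ZMod p × ZMod p)) =
      ({x : ZMod p | x ≠ 0} : Finset (ZMod p)).map ⟨fun x => (x, 0), fun x y h =>
        (Prod.ext_iff.mp h).1⟩ := by
    ext ⟨x, y⟩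
    simp only [Finset.mem_filter, Finset.mem_univ, true_and, Finset.mem_map,
      Function.Embedding.coeFn_mk, Prod.mk.injEq]
    constructor
    · intro h
      have hy : y = 0 := by
        by_contra hy
        let i : Fin k := ⟨(-(x * y⁻¹)).val, lt_of_lt_of_le (ZMod.val_lt _) hk⟩
        apply h i
        show x + (((-(x * y⁻¹)).val : ℕ) : ZMod p) * y = 0
        rw [ZMod.natCast_zmod_val, neg_mul, inv_mul_cancel_right₀ hy, add_neg_cancel]
      have hx : x ≠ 0 := by
        have := h ⟨0, lt_of_lt_of_le hp.out.pos hk⟩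
        simpa using this
      exact ⟨x, hx, rfl, hy.symm⟩
    · rintro ⟨a, ha, rfl, rfl⟩
      intro i
      simpa using ha
  rw [hset, Finset.card_map, Finset.filter_ne' Finset.univ (0 : ZMod p),
    Finset.card_erase_of_mem (Finset.mem_univ _), Finset.card_univ, ZMod.card]

/-- Hence `goodCount (apSystem k) p = p − 1` for primes `p ≤ k`.
[cite: GreenTao2010, proof of Lemma 1.3] -/
theorem APSystem_goodCount_of_le {p : ℕ} [hp : Fact p.Prime] (hk : p ≤ k) :
    goodCount (apSystem k) p = p - 1 := by
  classical
  rw [← APSystem_card_good_of_le hk]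
  unfold goodCount
  refine Finset.card_equiv (finTwoArrowEquiv (ZMod p)) fun v => ?_
  simp [APSystem.modEval_eq]

/-- **`β_p` for primes `p ≤ k`**: `β_p = p^{-2} (p/(p−1))^k (p − 1) = (1/p)(p/(p−1))^{k−1}`.
[cite: GreenTao2010, §1 Example 8] -/
theorem localFactor_apSystem_of_le {p : ℕ} (hp : p.Prime) (hk : p ≤ k) :
    localFactor (apSystem k) p = 1 / p * ((p : ℝ) / (p - 1)) ^ (k - 1) := by
  classical
  haveI := Fact.mk hp
  obtain ⟨m, rfl⟩ : ∃ m, k = m + 1 := ⟨k - 1, by have := hp.two_le; omega⟩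
  have hp0 : (p : ℝ) ≠ 0 := by exact_mod_cast hp.ne_zero
  have hp1 : (p : ℝ) - 1 ≠ 0 := by
    have : (2 : ℝ) ≤ p := by exact_mod_cast hp.two_le
    linarith
  rw [localFactor_prime, APSystem_goodCount_of_le hk, Nat.add_sub_cancel, Nat.cast_sub hp.one_le,
    Nat.cast_one, pow_succ ((p : ℝ) / (p - 1)) m, mul_assoc (((p : ℝ) / (p - 1)) ^ m),
    div_mul_cancel₀ (p : ℝ) hp1]
  field_simp

/-- Green–Tao's `β_p` for `k`-term progressions: `(1/p)(p/(p−1))^{k−1}` for `p ≤ k` and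
`(1 − (k−1)/p)(p/(p−1))^{k−1}` for `p ≥ k` (the two agree at `p = k`).
[cite: GreenTao2010, §1 Example 8] -/
def apLocalFactor (k p : ℕ) : ℝ :=
  if p ≤ k then 1 / p * ((p : ℝ) / (p - 1)) ^ (k - 1)
  else (1 - ((k : ℝ) - 1) / p) * ((p : ℝ) / (p - 1)) ^ (k - 1)

/-- **`β_p(apSystem k) = β_p` of Example 8** at every prime (`k ≥ 1`).
[cite: GreenTao2010, §1 Example 8, (1.6)] -/
theorem localFactor_apSystem (hk : 1 ≤ k) {p : ℕ} (hp : p.Prime) :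
    localFactor (apSystem k) p = apLocalFactor k p := by
  unfold apLocalFactor
  split_ifs with hpk
  · exact localFactor_apSystem_of_le hp hpk
  · rw [APSystem.localFactor_eq hp (by omega) hk]
    have hp0 : (p : ℝ) ≠ 0 := by exact_mod_cast hp.ne_zero
    have hp1 : (p : ℝ) - 1 ≠ 0 := by
      have : (2 : ℝ) ≤ p := by exact_mod_cast hp.two_le
      linarith
    rw [show (1 : ℝ) - 1 / p = ((p : ℝ) / (p - 1))⁻¹ by field_simp, inv_pow, div_inv_eq_mul]

/-- The partial singular products are the explicit Euler products of Example 8.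
[cite: GreenTao2010, §1 Example 8] -/
theorem singularProductPartial_apSystem (hk : 1 ≤ k) (x : ℕ) :
    singularProductPartial (apSystem k) x = ∏ p ∈ Nat.primesLE x, apLocalFactor k p := by
  unfold singularProductPartial
  exact Finset.prod_congr rfl fun p hp => localFactor_apSystem hk (Nat.prime_of_mem_primesLE hp)

/-! ### The archimedean factor `β_∞ = (N − k)²/(2(k−1))` -/

/-- [folklore] -/
private theorem hasDerivAt_ap_prim (c M x : ℝ) :
    HasDerivAt (fun x : ℝ => (M / c - 1) * x - x ^ 2 / (2 * c)) ((M - x) / c - 1) x := by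
  have h1 : HasDerivAt (fun x : ℝ => (M / c - 1) * x) (M / c - 1) x := by
    simpa using (hasDerivAt_id x).const_mul (M / c - 1)
  have h2 : HasDerivAt (fun x : ℝ => x ^ 2 / (2 * c)) (2 * x / (2 * c)) x := by
    simpa using (hasDerivAt_pow 2 x).div_const (2 * c)
  have h := h1.sub h2
  have e : M / c - 1 - 2 * x / (2 * c) = (M - x) / c - 1 := by ring
  rw [e] at h
  exact h

/-- [folklore] -/
private theorem integral_ap_height {c : ℝ} (hc : 0 < c) (M : ℝ) :
    ∫ x in (1 : ℝ)..(M - c), ((M - x) / c - 1) = (M - 1 - c) ^ 2 / (2 * c) := by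
  rw [intervalIntegral.integral_eq_sub_of_hasDerivAt (fun x _ => hasDerivAt_ap_prim c M x)
    ((by fun_prop : Continuous fun x : ℝ => (M - x) / c - 1).intervalIntegrable _ _)]
  field_simp
  ring

/-- [folklore] The area of `{1 ≤ x, 1 ≤ y, x + cy ≤ M}` is `(M − 1 − c)²/(2c)` (`c > 0`,
`M ≥ 1 + c`). -/
private theorem volume_apTriangle {c M : ℝ} (hc : 0 < c) (hM : 1 + c ≤ M) :
    (volume {p : ℝ × ℝ | 1 ≤ p.1 ∧ 1 ≤ p.2 ∧ p.1 + c * p.2 ≤ M}).toReal =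
      (M - 1 - c) ^ 2 / (2 * c) := by
  set E : Set (ℝ × ℝ) := {p | 1 ≤ p.1 ∧ 1 ≤ p.2 ∧ p.1 + c * p.2 ≤ M} with hE
  have hEm : MeasurableSet E := by
    have : E = {p : ℝ × ℝ | 1 ≤ p.1} ∩ ({p : ℝ × ℝ | 1 ≤ p.2} ∩ {p : ℝ × ℝ | p.1 + c * p.2 ≤ M}) := by
      ext p; simp [hE]
    rw [this]
    exact (isClosed_le continuous_const continuous_fst).measurableSet.inter
      ((isClosed_le continuous_const continuous_snd).measurableSet.inter
        (isClosed_le (by fun_prop) continuous_const).measurableSet)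
  rw [show (volume : Measure (ℝ × ℝ)) = volume.prod volume from rfl, Measure.prod_apply hEm]
  have hsec : ∀ x : ℝ, volume (Prod.mk x ⁻¹' E) =
      (Set.Ici (1 : ℝ)).indicator (fun x => ENNReal.ofReal ((M - x) / c - 1)) x := by
    intro x
    by_cases hx : 1 ≤ x
    · rw [Set.indicator_of_mem (Set.mem_Ici.mpr hx)]
      have : Prod.mk x ⁻¹' E = Set.Icc 1 ((M - x) / c) := by
        ext y
        simp only [Set.mem_preimage, hE, Set.mem_setOf_eq, Set.mem_Icc]
        rw [le_div_iff₀ hc]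
        constructor
        · rintro ⟨-, h1, h2⟩; exact ⟨h1, by linarith⟩
        · rintro ⟨h1, h2⟩; exact ⟨hx, h1, by linarith⟩
      rw [this, Real.volume_Icc]
    · rw [Set.indicator_of_notMem (by simpa using hx)]
      have : Prod.mk x ⁻¹' E = ∅ := by
        ext y
        simp only [Set.mem_preimage, hE, Set.mem_setOf_eq, Set.mem_empty_iff_false, iff_false]
        exact fun h => hx h.1
      rw [this, measure_empty]
  rw [lintegral_congr hsec, lintegral_indicator measurableSet_Ici,
    ← Set.Icc_union_Ioi_eq_Ici (show (1 : ℝ) ≤ M - c by linarith),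
    lintegral_union measurableSet_Ioi
      (Set.disjoint_left.mpr fun y hy hy' => not_lt.mpr (Set.mem_Icc.mp hy).2 (Set.mem_Ioi.mp hy'))]
  have hzero : ∫⁻ x in Set.Ioi (M - c), ENNReal.ofReal ((M - x) / c - 1) = 0 :=
    setLIntegral_eq_zero measurableSet_Ioi fun x hx => by
      simp only [Set.mem_Ioi] at hx
      simp only [Pi.zero_apply]
      refine ENNReal.ofReal_of_nonpos ?_
      rw [sub_nonpos, div_le_one hc]
      linarith
  rw [hzero, add_zero]
  have hint : IntegrableOn (fun x : ℝ => (M - x) / c - 1) (Set.Icc 1 (M - c)) volume :=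
    (by fun_prop : Continuous fun x : ℝ => (M - x) / c - 1).integrableOn_Icc
  have hnn : 0 ≤ᵐ[volume.restrict (Set.Icc 1 (M - c))] fun x : ℝ => (M - x) / c - 1 :=
    ae_restrict_of_forall_mem measurableSet_Icc fun x hx => by
      simp only [Set.mem_Icc] at hx
      simp only [Pi.zero_apply, sub_nonneg]
      rw [one_le_div hc]
      linarith
  rw [← ofReal_integral_eq_lintegral_ofReal hint hnn, integral_Icc_eq_integral_Ioc,
    ← intervalIntegral.integral_of_le (by linarith), integral_ap_height hc M,
    ENNReal.toReal_ofReal (by positivity)]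

/-- **`β_∞` for `k`-term progressions** (`2 ≤ k ≤ N`): the positive part of the triangle
`{1 ≤ x, 1 ≤ y, x + (k−1)y ≤ N}` is the triangle itself, of area `(N − k)²/(2(k−1))`
("`β_∞ = N²/6`" up to `O(N)` at `k = 4`). [cite: GreenTao2010, (1.4), §1 Examples 5 and 8] -/
theorem archFactor_apSystem (hk : 2 ≤ k) {N : ℕ} (hN : k ≤ N) :
    archFactor (apSystem k) (apRegion k N) = ((N : ℝ) - k) ^ 2 / (2 * ((k : ℝ) - 1)) := by
  unfold archFactor
  have hk' : (2 : ℝ) ≤ k := by exact_mod_cast hk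
  have hN' : (k : ℝ) ≤ N := by exact_mod_cast hN
  have hc : (0 : ℝ) < (k : ℝ) - 1 := by linarith
  have hset : apRegion k N ∩ {x | ∀ i, 0 < (apSystem k i).realEval x} =
      MeasurableEquiv.finTwoArrow ⁻¹'
        {p : ℝ × ℝ | 1 ≤ p.1 ∧ 1 ≤ p.2 ∧ p.1 + ((k : ℝ) - 1) * p.2 ≤ N} := by
    ext x
    constructor
    · rintro ⟨hx, -⟩
      simpa [apRegion, MeasurableEquiv.finTwoArrow_apply] using hx
    · intro hx
      have hx' : x ∈ apRegion k N := by
        simpa [apRegion, MeasurableEquiv.finTwoArrow_apply] using hx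
      exact ⟨hx', fun i => realEval_apSystem_pos hx' i⟩
  have hEm : MeasurableSet {p : ℝ × ℝ | 1 ≤ p.1 ∧ 1 ≤ p.2 ∧ p.1 + ((k : ℝ) - 1) * p.2 ≤ N} := by
    have : {p : ℝ × ℝ | 1 ≤ p.1 ∧ 1 ≤ p.2 ∧ p.1 + ((k : ℝ) - 1) * p.2 ≤ N} =
        {p : ℝ × ℝ | 1 ≤ p.1} ∩ ({p : ℝ × ℝ | 1 ≤ p.2} ∩
          {p : ℝ × ℝ | p.1 + ((k : ℝ) - 1) * p.2 ≤ N}) := by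
      ext p; simp
    rw [this]
    exact (isClosed_le continuous_const continuous_fst).measurableSet.inter
      ((isClosed_le continuous_const continuous_snd).measurableSet.inter
        (isClosed_le (by fun_prop) continuous_const).measurableSet)
  rw [hset, (volume_preserving_finTwoArrow ℝ).measure_preimage hEm.nullMeasurableSet,
    volume_apTriangle hc (by linarith)]
  congr 1
  ring

/-! ### Example 8 from the Main Theorem at complexity `k − 2` -/

/-- **Green–Tao 2010, Example 8 (APs of length `k`), from the Main Theorem at complexity
`k − 2`.** Assume the Main Theorem for systems of complexity `≤ k − 2` (Green–Tao's standing
hypotheses `GI(k−2)`, `MN(k−2)` enter only through it). Then for every `ε > 0` and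
`N ≥ N₀(k, ε)`:
`|#{p₁ < ⋯ < p_k ≤ N primes in AP} − (1/(2(k−1))) ∏_p β_p · N²/log^k N| ≤ ε N²/log^k N`,
with `β_p` as in `apLocalFactor` (`localFactor_apSystem`). [cite: GreenTao2010, §1 Example 8] -/
theorem GreenTao2010_example8 (hk : 2 ≤ k) (h : GreenTao2010_mainTheoremAtComplexity (k - 2)) :
    ∀ ε : ℝ, 0 < ε → ∃ N₀ : ℕ, ∀ N : ℕ, N₀ ≤ N →
      |(primeAPCount k N : ℝ) -
          1 / (2 * ((k : ℝ) - 1)) * singularProduct (apSystem k) * (N : ℝ) ^ 2 / Real.log N ^ k| ≤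
        ε * (N : ℝ) ^ 2 / Real.log N ^ k := by
  intro ε hε
  obtain ⟨m, rfl⟩ : ∃ m, k = m + 2 := ⟨k - 2, by omega⟩
  rw [Nat.add_sub_cancel] at h
  have hS0 : 0 < singularProduct (apSystem (m + 2)) := APSystem.singularProduct_pos (by omega)
  set S : ℝ := singularProduct (apSystem (m + 2)) with hS
  have hc : (0 : ℝ) < (((m + 2 : ℕ) : ℝ) - 1) := by push_cast; linarith
  set c : ℝ := ((m + 2 : ℕ) : ℝ) - 1 with hcdef
  have hcm : c = (m : ℝ) + 1 := by rw [hcdef]; push_cast; ring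
  set ε' : ℝ := ε / (2 * (S / (2 * c) + 1)) with hε'
  have hε'0 : 0 < ε' := by positivity
  obtain ⟨N₁, hN₁⟩ := GreenTao2010_primePointCount_of_mainTheoremAtComplexity h 2 (m + 2)
    ((m + 2) * (m + 2)) (by norm_num) (by omega) ε' hε'0
  refine ⟨max (max N₁ (m + 2)) ⌈4 * S / ε⌉₊, fun N hN => ?_⟩
  have hN1 : N₁ ≤ N := le_trans (le_trans (le_max_left _ _) (le_max_left _ _)) hN
  have hNk : m + 2 ≤ N := le_trans (le_trans (le_max_right _ _) (le_max_left _ _)) hN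
  have hNc : ⌈4 * S / ε⌉₊ ≤ N := le_trans (le_max_right _ _) hN
  have hNε : 4 * S ≤ ε * N := by
    have h' := le_trans (Nat.le_ceil (4 * S / ε))
      (show (⌈4 * S / ε⌉₊ : ℝ) ≤ N by exact_mod_cast hNc)
    rw [div_le_iff₀ hε] at h'
    linarith
  have hNr : ((m + 2 : ℕ) : ℝ) ≤ N := by exact_mod_cast hNk
  have hN2 : (2 : ℝ) ≤ N := le_trans (by push_cast; linarith) hNr
  have hL : 0 < Real.log N ^ (m + 2) := pow_pos (Real.log_pos (by linarith)) _
  have key := hN₁ N hN1 (apSystem (m + 2)) (APSystem.isNondegenerate (m + 2))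
    (complexity_apSystem m).le (affLinSize_apSystem_le (m + 2) N) (apRegion (m + 2) N)
    (convex_apRegion (m + 2) N) (apRegion_subset_realBox (by omega) N)
  rw [← primeAPCount_eq (by omega), archFactor_apSystem (by omega) hNk] at key
  set P : ℝ := (primeAPCount (m + 2) N : ℝ)
  set Lg : ℝ := Real.log N ^ (m + 2)
  set A : ℝ := ((N : ℝ) - ((m + 2 : ℕ) : ℝ)) ^ 2 / (2 * c) with hA
  -- the main term moves by `O(N · 𝔖 / log^k N)`
  have hmN : ((N : ℝ) - ((m + 2 : ℕ) : ℝ)) ^ 2 ≤ (N : ℝ) ^ 2 := by nlinarith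
  have hdiff : |A * S / Lg - 1 / (2 * c) * S * (N : ℝ) ^ 2 / Lg| ≤ 2 * S * N / Lg := by
    rw [← sub_div, abs_div, abs_of_pos hL]
    refine div_le_div_of_nonneg_right ?_ hL.le
    have e : A * S - 1 / (2 * c) * S * (N : ℝ) ^ 2 =
        -(S * (((m + 2 : ℕ) : ℝ) * (2 * N - ((m + 2 : ℕ) : ℝ))) / (2 * c)) := by
      rw [hA]
      ring
    have hnum : 0 ≤ S * (((m + 2 : ℕ) : ℝ) * (2 * N - ((m + 2 : ℕ) : ℝ))) / (2 * c) :=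
      div_nonneg (mul_nonneg hS0.le (mul_nonneg (by positivity) (by linarith))) (by positivity)
    rw [e, abs_neg, abs_of_nonneg hnum, div_le_iff₀ (by positivity), hcm]
    push_cast
    nlinarith [hS0.le, mul_nonneg hS0.le (Nat.cast_nonneg m), mul_nonneg hS0.le (le_trans (by positivity) hNr)]
  have hmain : ε' * (A * S + (N : ℝ) ^ 2) ≤ ε / 2 * (N : ℝ) ^ 2 := by
    have h1 : A * S ≤ (N : ℝ) ^ 2 / (2 * c) * S :=
      mul_le_mul_of_nonneg_right (div_le_div_of_nonneg_right hmN (by positivity)) hS0.le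
    calc ε' * (A * S + (N : ℝ) ^ 2) ≤ ε' * ((N : ℝ) ^ 2 / (2 * c) * S + (N : ℝ) ^ 2) := by gcongr
      _ = ε / 2 * (N : ℝ) ^ 2 := by rw [hε']; field_simp
  have hsec : 2 * S * N ≤ ε / 2 * (N : ℝ) ^ 2 := by nlinarith
  calc |P - 1 / (2 * c) * S * (N : ℝ) ^ 2 / Lg|
      ≤ |P - A * S / Lg| + |A * S / Lg - 1 / (2 * c) * S * (N : ℝ) ^ 2 / Lg| := abs_sub_le _ _ _
    _ ≤ ε' * (A * S + (N : ℝ) ^ 2) / Lg + 2 * S * N / Lg := add_le_add key hdiff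
    _ ≤ ε / 2 * (N : ℝ) ^ 2 / Lg + ε / 2 * (N : ℝ) ^ 2 / Lg :=
        add_le_add (div_le_div_of_nonneg_right hmain hL.le) (div_le_div_of_nonneg_right hsec hL.le)
    _ = ε * (N : ℝ) ^ 2 / Lg := by ring

/-! ### The unconditional cases `k = 2, 3` and Example 5 (`k = 4`) -/

/-- `β_p = 1` for pairs (`k = 2`) at every prime. [cite: GreenTao2010, §1 Example 8] -/
theorem localFactor_apSystem_two {p : ℕ} (hp : p.Prime) : localFactor (apSystem 2) p = 1 := by
  rw [localFactor_apSystem (by norm_num) hp]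
  unfold apLocalFactor
  have hp0 : (p : ℝ) ≠ 0 := by exact_mod_cast hp.ne_zero
  have hp1 : (p : ℝ) - 1 ≠ 0 := by
    have : (2 : ℝ) ≤ p := by exact_mod_cast hp.two_le
    linarith
  split_ifs with h2
  · have : p = 2 := le_antisymm h2 hp.two_le
    subst this
    norm_num
  · norm_num
    field_simp

/-- Hence `∏_p β_p = 1` for pairs. [cite: GreenTao2010, §1 Example 8] -/
theorem singularProduct_apSystem_two : singularProduct (apSystem 2) = 1 := by
  have h1 : ∀ x, singularProductPartial (apSystem 2) x = 1 := fun x => by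
    unfold singularProductPartial
    exact Finset.prod_eq_one fun p hp => localFactor_apSystem_two (Nat.prime_of_mem_primesLE hp)
  have h1' : singularProductPartial (apSystem 2) = fun _ => (1 : ℝ) := funext h1
  have ht := APSystem.tendsto_singularProductPartial 2
  rw [h1'] at ht
  exact (tendsto_nhds_unique tendsto_const_nhds ht).symm

/-- **Example 8 at `k = 2` (unconditional; "equivalent to the prime number theorem"):** the
number of pairs of primes `p₁ < p₂ ≤ N` is `(½ + o(1)) N²/log² N`.
[cite: GreenTao2010, §1 Example 8 (k = 2)] -/
theorem GreenTao2010_example8_two : ∀ ε : ℝ, 0 < ε → ∃ N₀ : ℕ, ∀ N : ℕ, N₀ ≤ N →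
    |(primeAPCount 2 N : ℝ) - 1 / 2 * (N : ℝ) ^ 2 / Real.log N ^ 2| ≤
      ε * (N : ℝ) ^ 2 / Real.log N ^ 2 := by
  intro ε hε
  obtain ⟨N₀, hN₀⟩ := GreenTao2010_example8 (k := 2) le_rfl GreenTao2010_mainTheoremAtComplexity_zero ε hε
  refine ⟨N₀, fun N hN => ?_⟩
  have := hN₀ N hN
  rw [singularProduct_apSystem_two] at this
  norm_num at this
  exact this

/-- **Example 8 at `k = 3`** is van der Corput's theorem `GreenTao2010_example8_three`
(`PrimeThreeTermProgressionsAsymptotic`, unconditional); in the present parametrisation: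
for `N ≥ N₀(ε)`, `|primeAPCount 3 N − ¼ ∏_p β_p(apSystem 3) · N²/log³ N| ≤ ε N²/log³ N`.
[cite: GreenTao2010, §1 Example 8 (k = 3)] -/
theorem GreenTao2010_example8_three_ap : ∀ ε : ℝ, 0 < ε → ∃ N₀ : ℕ, ∀ N : ℕ, N₀ ≤ N →
    |(primeAPCount 3 N : ℝ) -
        (1 / 4 : ℝ) * singularProduct (apSystem 3) * (N : ℝ) ^ 2 / Real.log N ^ 3| ≤
      ε * (N : ℝ) ^ 2 / Real.log N ^ 3 := by
  intro ε hε
  obtain ⟨N₀, hN₀⟩ := GreenTao2010_example8 (k := 3) (by norm_num)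
    GreenTao2010_mainTheoremAtComplexity_one ε hε
  refine ⟨N₀, fun N hN => ?_⟩
  have := hN₀ N hN
  norm_num at this ⊢
  exact this

/-- **`β_p` for four-term progressions** (Green–Tao's Example 5 values): `β₂ = 4`, `β₃ = 9/8`,
`β_p = 1 − (3p − 1)/(p − 1)³` for `p ≥ 5`. [cite: GreenTao2010, §1 Example 5] -/
theorem localFactor_apSystem_four {p : ℕ} (hp : p.Prime) :
    localFactor (apSystem 4) p =
      if p = 2 then 4 else if p = 3 then 9 / 8 else 1 - (3 * (p : ℝ) - 1) / ((p : ℝ) - 1) ^ 3 := by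
  rw [localFactor_apSystem (by norm_num) hp]
  unfold apLocalFactor
  have hp0 : (p : ℝ) ≠ 0 := by exact_mod_cast hp.ne_zero
  have hp1 : (p : ℝ) - 1 ≠ 0 := by
    have : (2 : ℝ) ≤ p := by exact_mod_cast hp.two_le
    linarith
  by_cases h2 : p = 2
  · subst h2; norm_num
  by_cases h3 : p = 3
  · subst h3; norm_num
  have h4 : ¬ p ≤ 4 := by
    intro h
    interval_cases p <;> simp_all (config := {decide := true})
  rw [if_neg h4, if_neg h2, if_neg h3]
  norm_num
  field_simp
  ring

/-- **Green–Tao 2010, Example 5 (APs of length 4), from `GI(2)` and `MN(2)`.** Assuming the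
inverse `U³` theorem `GITwo` and the Möbius–nilsequences estimate `MNTwo` (named facts; theorems
of Green–Tao in print), for `N ≥ N₀(ε)`:
`|#{p₁ < p₂ < p₃ < p₄ ≤ N in AP} − 𝔖₁ N²/log⁴ N| ≤ ε N²/log⁴ N` with
`𝔖₁ = (1/6) ∏_p β_p` (`= ¾ ∏_{p ≥ 5}(1 − (3p−1)/(p−1)³)`, since `β₂ β₃ / 6 = 4 · (9/8)/6 = ¾`;
`localFactor_apSystem_four`). [cite: GreenTao2010, §1 Example 5] -/
theorem GreenTao2010_example5_of_GI_of_MN (hGI : GreenTaoLevelTwo.GITwo)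
    (hMN : GreenTaoLevelTwo.MNTwo) :
    ∀ ε : ℝ, 0 < ε → ∃ N₀ : ℕ, ∀ N : ℕ, N₀ ≤ N →
      |(primeAPCount 4 N : ℝ) -
          1 / 6 * singularProduct (apSystem 4) * (N : ℝ) ^ 2 / Real.log N ^ 4| ≤
        ε * (N : ℝ) ^ 2 / Real.log N ^ 4 := by
  intro ε hε
  obtain ⟨N₀, hN₀⟩ := GreenTao2010_example8 (k := 4) (by norm_num)
    (GreenTao2010_mainTheoremAtComplexity_two_of_GI_of_MN hGI hMN) ε hε
  refine ⟨N₀, fun N hN => ?_⟩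
  have := hN₀ N hN
  norm_num at this ⊢
  exact this

end Literature.NumberTheory.Sieve

end
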